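import Mathlib
import HarnessLib
import Literature.MathematicalPhysics.StatisticalMechanics.FluctuationKernelComparisonTraceTorusFRD
import Literature.MathematicalPhysics.StatisticalMechanics.FluctuationKernelComparisonMidLocalTorusFRD

/-!
# The FIRST-ORDER part of the `ℓ = 2` kernel comparison on the full torus (all scales `k + 1 ≤ N + 1`,
# in particular the LAST one): `‖fluct C̄ F − fluct 𝒞_{1+q+h,k+1} F‖_{k:k+1,X} ≤ b·((r₀+1)·8q_H·h⁽²⁾)·κ^{|X|_k}`,
# `C̄ = ½(𝒞_{1+q,k+1} + 𝒞_{1+q+2h,k+1})`, `h⁽²⁾ = (3^{d+1} L^{(N−(k+1))d})^{1/2}·(½(Σ|h|)²·K⁽²⁾)`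

Companion of `FluctuationKernelComparisonMidLocalTorusFRD` (the volume-uniform localised form, which needs
`k + 1 ≤ N̄ ≤ N`): here the dimension-free Lemma 8.4 (`tayNormLE_fluct_sub_fluct_of_sum_sq_pow_abkm`) is applied
on the full torus `(ℤ/L^N)^d`, exactly as `tayNormLE_fluct_sub_fluct_trace_of_torusFRD` does for `ℓ = 1`; at
the last scale `k = N` the factor `L^{(N−(k+1))d}` is `1`, which is what the `ℓ = 2` slot of the last
integration step (F4Φ22) uses.  The pair is `(C̄, C₁)`, `C₁ = 𝒞_{1+q+h,k+1}`, with the relative multiplier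
bound `ρ⁽²⁾_j = ½K⁽²⁾_j(Σ|h|)²` of `TorusFRDKernelSecondDiffShell` and `StepKernelBounds` of the convex
combinations from `TorusFRDStepKernelConvex`.

* **`tayNormLE_fluct_mid_sub_fluct_trace_of_torusFRD`**.

## References
* S. Adams, S. Buchholz, R. Kotecký, S. Müller, arXiv:1910.13564, Lemma 8.4, Lemma 12.6
  [AdamsBuchholzKoteckyMuller2019].
* S. Buchholz, J. Funct. Anal. 275 (2018), Thm 4.5 [Buchholz2016].
-/

noncomputable section

namespace Literature.MathematicalPhysics.StatisticalMechanics.GradientRG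

open scoped BigOperators
open Real Set Finset MeasureTheory
open Literature.MathematicalPhysics.StatisticalMechanics.GradientFRD
  (fourierCoeff cExt cExt_of_mem IsElliptic IsUnitSymm InShell iterDiff supNorm conv ellOp isElliptic_one
    exists_inShell inShell_le re_fourierCoeff_zero_of_sum_eq_zero)
open Literature.MathematicalPhysics.StatisticalMechanics.TorusPolymer (IsPolymer numBlocks thicken)
open Literature.MathematicalPhysics.QuantumFieldTheory

variable {d M : ℕ} [NeZero M]

section Package

variable {L N Mord R n ñ : ℕ} {θbar lam μ δ₁ δ₀ A𝒫 : ℝ}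
    {𝒞 : Matrix (Fin d) (Fin d) ℝ → ℕ → (Fin d → ZMod M) → ℝ} {Mc : ℕ → ℝ}
    {Cα : (Fin d → ℕ) → ℕ → ℝ} {c C : ℝ} {Cℓ : ℕ → ℝ}

set_option maxHeartbeats 3200000 in
/-- **First-order part of the `ℓ = 2` comparison on the full torus**: for one `TorusFRD` package with the
gap `d + 1 ≤ 2(ñ−n)` on `(ℤ/L^N)^d`, symmetric `q`, `h` with `q, q+h, q+2h` in the ball `Σ|·| ≤ T₀`
(`T₀ ≤ ½`, `K T₀ ≤ log(1+ρ)`, `ρ < θ̄`), Hölder conjugates `p, q_H` with `p(1+ρ) ≤ 1+ρ''` (`ρ'' < θ̄`),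
`k + 1 ≤ N + 1`, a `k`-polymer `X` and a `T_k^{X*}`-local `C^{r₀}` functional `F` with `‖F‖_{k,X} ≤ b`:
`‖fluct C̄ F − fluct 𝒞_{1+q+h,k+1} F‖_{k:k+1,X} ≤ b·((r₀+1)·8q_H·h⁽²⁾)·κ^{|X|_k}`,
`h⁽²⁾ = (3^{d+1} L^{(N−(k+1))d})^{1/2}·(½(Σ|h|)²·K⁽²⁾)`, `K⁽²⁾ = shellRatioConst c (Cℓ 2) L d ñ`.
[cite: AdamsBuchholzKoteckyMuller2019, Lemma 8.4 / Lemma 12.6] -/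
theorem tayNormLE_fluct_mid_sub_fluct_trace_of_torusFRD
    (hd : 3 ≤ d) (hMord : 1 ≤ Mord) (hMR : Mord ≤ R) (hLodd : Odd L) (hL : 2 ^ (d + 3) + 16 * R ≤ L)
    (hM : M = L ^ N)
    (hθbar : 0 < θbar) (hlam : 0 < lam) (hn : 2 * Mord ≤ n) (hn2 : 2 ≤ n) (hnñ : n ≤ ñ)
    (hgap : d + 1 ≤ 2 * (ñ - n))
    (hc : 0 < c) (hC1 : 0 ≤ Cℓ 1) (hC2 : 0 ≤ Cℓ 2)
    (hallA : ∀ A : Matrix (Fin d) (Fin d) ℝ, IsElliptic (1 / 2 : ℝ) 2 A →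
        (∀ k, 1 ≤ k → k ≤ N + 1 →
          ∑ x : Fin d → ZMod M, 𝒞 A k x = 0 ∧ ∀ x, 𝒞 A k (-x) = 𝒞 A k x) ∧
        (∀ k, 1 ≤ k → k ≤ N + 1 → ∀ φ : (Fin d → ZMod M) → ℝ, ∑ x, φ x = 0 →
          0 ≤ ∑ x, ∑ y, φ x * 𝒞 A k (x - y) * φ y) ∧
        (∀ φ : (Fin d → ZMod M) → ℝ, ∑ x, φ x = 0 →
          ellOp A (conv (fun x => ∑ k ∈ Finset.Icc 1 (N + 1), 𝒞 A k x) φ) = φ) ∧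
        (∀ k, 1 ≤ k → k ≤ N → Mc k ≤ 0 ∧
          ∀ x : Fin d → ZMod M, ((L : ℝ) ^ k) / 2 ≤ (supNorm x : ℝ) →
            𝒞 A k x = Mc k) ∧
        (∀ k, 1 ≤ k → k ≤ N + 1 → ∀ B : Matrix (Fin d) (Fin d) ℝ, IsUnitSymm B →
          (∃ ε : ℝ, 0 < ε ∧ ∀ x : Fin d → ZMod M,
            ContDiffOn ℝ ⊤ (fun s : ℝ => 𝒞 (A + s • B) k x) (Set.Ioo (-ε) ε)) ∧
          ∀ α : Fin d → ℕ, ∑ i, α i ≤ n → ∀ ℓ : ℕ, ∀ x : Fin d → ZMod M,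
            abs (iteratedDeriv ℓ (fun s : ℝ => iterDiff α (𝒞 (A + s • B) k) x) 0)
              ≤ Cα α ℓ / (L : ℝ) ^ ((k - 1) * (d - 2 + ∑ i, α i))) ∧
        (∀ k, 1 ≤ k → k ≤ N + 1 → ∀ j : ℕ, ∀ κ : Fin d → ZMod M, κ ≠ 0 → InShell L j κ →
          (j < k →
            c / (L : ℝ) ^ (2 * (d + ñ) + 1) * (L : ℝ) ^ (2 * j)
                / (L : ℝ) ^ ((k - j) * (d - 1 + n)) ≤ (fourierCoeff (𝒞 A k) κ).re ∧
            ‖fourierCoeff (𝒞 A k) κ‖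
              ≤ C * (L : ℝ) ^ (2 * (d + ñ) + 1) * (L : ℝ) ^ (2 * j)
                  / (L : ℝ) ^ ((k - j) * (d - 1 + n))) ∧
          (k ≤ j →
            c / (L : ℝ) ^ (2 * (d + ñ) + 1) * (L : ℝ) ^ (2 * k)
                ≤ (fourierCoeff (𝒞 A k) κ).re ∧
            ‖fourierCoeff (𝒞 A k) κ‖ ≤ C * (L : ℝ) ^ (2 * k)) ∧
          ∀ B : Matrix (Fin d) (Fin d) ℝ, IsUnitSymm B → ∀ ℓ : ℕ, 1 ≤ ℓ →
            (j < k →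
              ‖iteratedDeriv ℓ (fun s : ℝ => fourierCoeff (𝒞 (A + s • B) k) κ) 0‖
                ≤ Cℓ ℓ * (L : ℝ) ^ (2 * (d + ñ) + 1) * (L : ℝ) ^ (2 * j)
                    / (L : ℝ) ^ ((k - j) * (d - 1 + ñ))) ∧
            (k ≤ j →
              ‖iteratedDeriv ℓ (fun s : ℝ => fourierCoeff (𝒞 (A + s • B) k) κ) 0‖
                ≤ Cℓ ℓ * (L : ℝ) ^ (2 * k))))
    (hB : AbkmWeightBounds L N Mord R n θbar lam μ δ₁ δ₀ A𝒫 (fun j => 𝒞 1 j)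
      (abkmWeightData L N Mord R θbar (schedDelta δ₀ δ₁ N) fun j => 𝒞 1 j))
    {k : ℕ} (hk : k + 1 ≤ N + 1) {ρ : ℝ} (hρ0 : 0 ≤ ρ) (hρ : ρ < θbar)
    {T₀ : ℝ} (hT₀ : T₀ ≤ 1 / 2) (hKT₀ : shellRatioConst c (Cℓ 1) (L : ℝ) d ñ * T₀ ≤ Real.log (1 + ρ))
    {q y : Matrix (Fin d) (Fin d) ℝ} (hq : q.IsSymm) (hh : y.IsSymm)
    (hqT : ∑ i, ∑ j, |q i j| ≤ T₀) (hqhT : ∑ i, ∑ j, |(q + y) i j| ≤ T₀)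
    (hq2hT : ∑ i, ∑ j, |(q + (2 : ℝ) • y) i j| ≤ T₀)
    {p qH ρ'' : ℝ} (hpq : p.HolderConjugate qH) (hρ''0 : 0 ≤ ρ'') (hρ'' : ρ'' < θbar)
    (hpρ : p * (1 + ρ) ≤ 1 + ρ'')
    {pT r₀ : ℕ} {h A : ℝ} {X : Finset (Fin d → ZMod M)} (hX : IsPolymer (L ^ k) X)
    {F : ((Fin d → ZMod M) → ℝ) → ℂ} {b : ℝ} (hb : 0 ≤ b) (hFd : ContDiff ℝ r₀ F)
    (hFloc : IsGaugeLocal ((abkmNormParams L N Mord R pT r₀ h θbar A (schedDelta δ₀ δ₁ N)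
      fun j => 𝒞 1 j).gauge k X) F)
    (hF : TayNormLE ((abkmNormParams L N Mord R pT r₀ h θbar A (schedDelta δ₀ δ₁ N) fun j => 𝒞 1 j).gauge k X)
      r₀ ((abkmWeightData L N Mord R θbar (schedDelta δ₀ δ₁ N) fun j => 𝒞 1 j).weight k X) F b) :
    TayNormLE ((abkmNormParams L N Mord R pT r₀ h θbar A (schedDelta δ₀ δ₁ N) fun j => 𝒞 1 j).gauge k X) r₀
      ((abkmWeightData L N Mord R θbar (schedDelta δ₀ δ₁ N) fun j => 𝒞 1 j).midWeight k X)
      (fluct (fun x => 2⁻¹ * 𝒞 ((1 : Matrix (Fin d) (Fin d) ℝ) + q) (k + 1) x +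
          2⁻¹ * 𝒞 ((1 : Matrix (Fin d) (Fin d) ℝ) + (q + (2 : ℝ) • y)) (k + 1) x) F -
        fluct (𝒞 ((1 : Matrix (Fin d) (Fin d) ℝ) + (q + y)) (k + 1)) F)
      (b * ((r₀ + 1) * (8 * qH *
          (Real.sqrt ((3 : ℝ) ^ (d + 1) * (L : ℝ) ^ ((N - (k + 1)) * d)) *
            (2⁻¹ * (∑ i, ∑ j, |y i j|) ^ 2 * shellRatioConst c (Cℓ 2) (L : ℝ) d ñ)))) *
        (weightIntConstRho θbar ρ'' (traceConst d Mord R lam (derivSum d n fun θ' _ => Cα θ' 0)) ^ (1 / p)) ^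
          numBlocks (L ^ k) X) := by
  have h8 : 8 ≤ 2 ^ (d + 3) := by
    calc 8 = 2 ^ 3 := by norm_num
      _ ≤ 2 ^ (d + 3) := Nat.pow_le_pow_right (by norm_num) (by omega)
  have hL2 : 2 ≤ L := by omega
  have hL5 : 5 ≤ L := by omega
  have hL1 : 1 ≤ L := by omega
  have hd1 : 1 ≤ d := by omega
  have hd2 : 2 ≤ d := by omega
  have hL0 : (0 : ℝ) ≤ (L : ℝ) := Nat.cast_nonneg _
  have hL1r : (1 : ℝ) ≤ (L : ℝ) := by exact_mod_cast hL1
  have hp0 : 0 ≤ p := by linarith [hpq.lt]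
  -- the three points
  have hqh : (q + y).IsSymm := hq.add hh
  have hq2h : (q + (2 : ℝ) • y).IsSymm := hq.add (hh.smul _)
  have hq2 : ∑ i, ∑ j, |q i j| ≤ 1 / 2 := hqT.trans hT₀
  have hqh2 : ∑ i, ∑ j, |(q + y) i j| ≤ 1 / 2 := hqhT.trans hT₀
  have hq2h2 : ∑ i, ∑ j, |(q + (2 : ℝ) • y) i j| ≤ 1 / 2 := hq2hT.trans hT₀
  have hell₀ : IsElliptic (1 / 2 : ℝ) 2 ((1 : Matrix (Fin d) (Fin d) ℝ) + q) :=
    isElliptic_one_add_of_entrySum_le hq hq2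
  have hell₁ : IsElliptic (1 / 2 : ℝ) 2 ((1 : Matrix (Fin d) (Fin d) ℝ) + (q + y)) :=
    isElliptic_one_add_of_entrySum_le hqh hqh2
  have hell₂ : IsElliptic (1 / 2 : ℝ) 2 ((1 : Matrix (Fin d) (Fin d) ℝ) + (q + (2 : ℝ) • y)) :=
    isElliptic_one_add_of_entrySum_le hq2h hq2h2
  -- constants
  set K2 := shellRatioConst c (Cℓ 2) (L : ℝ) d ñ with hK2def
  have hK20 : 0 ≤ K2 := shellRatioConst_nonneg hc hC2 hL0 d ñ
  set T := ∑ i, ∑ j, |y i j| with hTdef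
  have hT0 : 0 ≤ T := sum_nonneg fun _ _ => sum_nonneg fun _ _ => abs_nonneg _
  set E := 2⁻¹ * T ^ 2 with hEdef
  have hE0 : 0 ≤ E := by positivity
  set Kj : ℕ → ℝ := fun j => K2 / (L : ℝ) ^ ((k + 1 - j) * (ñ - n)) with hKjdef
  have hKj0 : ∀ j, 0 ≤ Kj j := fun j => by positivity
  -- kernels
  set 𝒞₀ : (Fin d → ZMod M) → ℝ := 𝒞 ((1 : Matrix (Fin d) (Fin d) ℝ) + q) (k + 1) with h𝒞₀
  set 𝒞₁ : (Fin d → ZMod M) → ℝ := 𝒞 ((1 : Matrix (Fin d) (Fin d) ℝ) + (q + y)) (k + 1) with h𝒞₁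
  set 𝒞₂ : (Fin d → ZMod M) → ℝ := 𝒞 ((1 : Matrix (Fin d) (Fin d) ℝ) + (q + (2 : ℝ) • y)) (k + 1) with h𝒞₂
  set 𝒞a : (Fin d → ZMod M) → ℝ := fun x => 2⁻¹ * 𝒞₀ x + 2⁻¹ * 𝒞₂ x with h𝒞a
  have hA𝒫p : 0 ≤ weightIntConstRho θbar ρ'' (traceConst d Mord R lam (derivSum d n fun θ' _ => Cα θ' 0)) :=
    zero_le_one.trans (one_le_weightIntConstRho hθbar hρ''0 hρ''
      (traceConst_nonneg d Mord R hlam.le (derivSum_nonneg d n _)))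
  -- `StepKernelBounds` for `𝒞a`, `𝒞₁` and the segment between them
  have h1ρ : (1 : ℝ) * (1 + ρ) ≤ 1 + ρ := by rw [one_mul]
  have hSa : StepKernelBounds (abkmWeightData L N Mord R θbar (schedDelta δ₀ δ₁ N) fun j => 𝒞 1 j) L k
      (weightIntConstRho θbar ρ (traceConst d Mord R lam (derivSum d n fun θ' _ => Cα θ' 0)))
      (secondDiffConst fun θ' => Cα θ' 0) 𝒞a := by
    have h1 := stepKernelBounds_const_mul_convex3_of_torusFRD hd hMord hMR hLodd hL hθbar hlam hn hn2 hnñ hc hC1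
      hallA hB hk hρ0 hT₀ hKT₀ hq hqh hq2h hqT hqhT hq2hT (p := 1) zero_le_one hρ0 hρ h1ρ
      (a := 2⁻¹) (b := 0) (c₃ := 2⁻¹) (by norm_num) le_rfl (by norm_num) (by norm_num)
    have e : (fun x => (1 : ℝ) * (2⁻¹ * 𝒞 ((1 : Matrix (Fin d) (Fin d) ℝ) + q) (k + 1) x +
        0 * 𝒞 ((1 : Matrix (Fin d) (Fin d) ℝ) + (q + y)) (k + 1) x +
        2⁻¹ * 𝒞 ((1 : Matrix (Fin d) (Fin d) ℝ) + (q + (2 : ℝ) • y)) (k + 1) x)) = 𝒞a := by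
      funext x; simp only [h𝒞a, h𝒞₀, h𝒞₂]; ring
    rw [e, one_mul] at h1
    exact h1
  have hSb : StepKernelBounds (abkmWeightData L N Mord R θbar (schedDelta δ₀ δ₁ N) fun j => 𝒞 1 j) L k
      (weightIntConstRho θbar ρ (traceConst d Mord R lam (derivSum d n fun θ' _ => Cα θ' 0)))
      (secondDiffConst fun θ' => Cα θ' 0) 𝒞₁ :=
    stepKernelBounds_one_add_of_torusFRD hd hMord hMR hLodd hL hθbar hlam hn hn2 hnñ hc hC1 hallA hB hk
      hρ0 hρ hT₀ hKT₀ hqh hqhT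
  have hSp : ∀ t ∈ Set.Icc (0 : ℝ) 1,
      StepKernelBounds (abkmWeightData L N Mord R θbar (schedDelta δ₀ δ₁ N) fun j => 𝒞 1 j) L k
        (weightIntConstRho θbar ρ'' (traceConst d Mord R lam (derivSum d n fun θ' _ => Cα θ' 0)))
        (p * secondDiffConst fun θ' => Cα θ' 0)
        (fun x => p * (𝒞₁ x + t * (𝒞a x - 𝒞₁ x))) := by
    intro t ht
    have h1 := stepKernelBounds_const_mul_convex3_of_torusFRD hd hMord hMR hLodd hL hθbar hlam hn hn2 hnñ hc hC1
      hallA hB hk hρ0 hT₀ hKT₀ hq hqh hq2h hqT hqhT hq2hT hp0 hρ''0 hρ'' hpρ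
      (a := t / 2) (b := 1 - t) (c₃ := t / 2) (by linarith [ht.1]) (by linarith [ht.2]) (by linarith [ht.1])
      (by ring)
    have e : (fun x => p * (t / 2 * 𝒞 ((1 : Matrix (Fin d) (Fin d) ℝ) + q) (k + 1) x +
        (1 - t) * 𝒞 ((1 : Matrix (Fin d) (Fin d) ℝ) + (q + y)) (k + 1) x +
        t / 2 * 𝒞 ((1 : Matrix (Fin d) (Fin d) ℝ) + (q + (2 : ℝ) • y)) (k + 1) x)) =
        fun x => p * (𝒞₁ x + t * (𝒞a x - 𝒞₁ x)) := by
      funext x; simp only [h𝒞a, h𝒞₀, h𝒞₁, h𝒞₂]; ring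
    rw [e] at h1
    exact h1
  -- evenness, zero sums, positivity
  have ho₀ := (hallA _ hell₀).1 (k + 1) (by omega) hk
  have ho₁ := (hallA _ hell₁).1 (k + 1) (by omega) hk
  have ho₂ := (hallA _ hell₂).1 (k + 1) (by omega) hk
  have hea : ∀ x, 𝒞a (-x) = 𝒞a x := fun x => by simp only [h𝒞a, h𝒞₀, h𝒞₂, ho₀.2 x, ho₂.2 x]
  have heb : ∀ x, 𝒞₁ (-x) = 𝒞₁ x := ho₁.2
  have h0a : ∑ x, 𝒞a x = 0 := by
    simp only [h𝒞a, h𝒞₀, h𝒞₂, Finset.sum_add_distrib, ← Finset.mul_sum, ho₀.1, ho₂.1, mul_zero, add_zero]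
  have h0b : ∑ x, 𝒞₁ x = 0 := ho₁.1
  have hpos₀ : ∀ κ : Fin d → ZMod M, κ ≠ 0 → 0 < (fourierCoeff 𝒞₀ κ).re := fun κ hκ =>
    re_fourierCoeff_pos_of_torusFRD (hallA _ hell₀).2.2.2.2.2 hc hL2 (by omega) hk hκ
  have hpos₁ : ∀ κ : Fin d → ZMod M, κ ≠ 0 → 0 < (fourierCoeff 𝒞₁ κ).re := fun κ hκ =>
    re_fourierCoeff_pos_of_torusFRD (hallA _ hell₁).2.2.2.2.2 hc hL2 (by omega) hk hκ
  have hpos₂ : ∀ κ : Fin d → ZMod M, κ ≠ 0 → 0 < (fourierCoeff 𝒞₂ κ).re := fun κ hκ =>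
    re_fourierCoeff_pos_of_torusFRD (hallA _ hell₂).2.2.2.2.2 hc hL2 (by omega) hk hκ
  have heA : ∀ κ, (fourierCoeff 𝒞a κ).re = 2⁻¹ * (fourierCoeff 𝒞₀ κ).re + 2⁻¹ * (fourierCoeff 𝒞₂ κ).re :=
    fun κ => by rw [h𝒞a, re_fourierCoeff_half_add]
  have hposa : ∀ κ : Fin d → ZMod M, κ ≠ 0 → 0 < (fourierCoeff 𝒞a κ).re := fun κ hκ => by
    rw [heA]
    exact add_pos (mul_pos (by norm_num) (hpos₀ κ hκ)) (mul_pos (by norm_num) (hpos₂ κ hκ))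
  -- the mode-wise relative bound `ρ⁽²⁾_j = ½ K⁽²⁾_j T²`
  classical
  set ρm : (Fin d → ZMod M) → ℝ := fun κ =>
    if hκ : κ = 0 then 0 else 2⁻¹ * (Kj (Classical.choose (exists_inShell hL2 hκ)) * T ^ 2) with hρmdef
  have hρm_nonneg : ∀ κ, 0 ≤ ρm κ := by
    intro κ
    simp only [hρmdef]
    split_ifs
    · exact le_rfl
    · exact mul_nonneg (by norm_num) (mul_nonneg (hKj0 _) (sq_nonneg _))
  have hρm0 : ρm 0 = 0 := by simp only [hρmdef, dif_pos]
  have hshell : ∀ (κ : Fin d → ZMod M) (hκ : κ ≠ 0),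
      |(fourierCoeff 𝒞a κ).re - (fourierCoeff 𝒞₁ κ).re| ≤ ρm κ * (fourierCoeff 𝒞a κ).re ∧
        |(fourierCoeff 𝒞a κ).re - (fourierCoeff 𝒞₁ κ).re| ≤ ρm κ * (fourierCoeff 𝒞₁ κ).re := by
    intro κ hκ
    have hj := Classical.choose_spec (exists_inShell hL2 hκ)
    set j := Classical.choose (exists_inShell hL2 hκ) with hjdef
    have hcmp := fun (p' : Matrix (Fin d) (Fin d) ℝ) (hp' : p' = q ∨ p' = q + y ∨ p' = q + (2 : ℝ) • y) =>
      norm_fourierCoeff_one_add_line_secondDiff_le_shell_of_torusFRD (fun A hA => (hallA A hA).2.2.2.2.1)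
        (fun A hA => (hallA A hA).2.2.2.2.2) hc hC2 hL1 hnñ hq hh hq2 hq2h2 (k := k + 1) (by omega) hk hκ hj hp'
    have hρκ : ρm κ = 2⁻¹ * (Kj j * T ^ 2) := by simp only [hρmdef, dif_neg hκ, hjdef]
    set Δ : ℂ := fourierCoeff 𝒞₂ κ - 2 * fourierCoeff 𝒞₁ κ + fourierCoeff 𝒞₀ κ with hΔ
    have hdiff : (fourierCoeff 𝒞a κ).re - (fourierCoeff 𝒞₁ κ).re = 2⁻¹ * Δ.re := by
      rw [heA, hΔ]
      simp only [Complex.add_re, Complex.sub_re, Complex.mul_re, Complex.re_ofNat, Complex.im_ofNat, zero_mul,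
        sub_zero]
      ring
    have hΔle : ∀ (p' : Matrix (Fin d) (Fin d) ℝ), (p' = q ∨ p' = q + y ∨ p' = q + (2 : ℝ) • y) →
        |(fourierCoeff 𝒞a κ).re - (fourierCoeff 𝒞₁ κ).re| ≤
          2⁻¹ * (Kj j * T ^ 2) * (fourierCoeff (𝒞 ((1 : Matrix (Fin d) (Fin d) ℝ) + p') (k + 1)) κ).re := by
      intro p' hp'
      rw [hdiff, abs_mul, abs_of_pos (by norm_num : (0 : ℝ) < 2⁻¹), mul_assoc]
      refine mul_le_mul_of_nonneg_left ((Complex.abs_re_le_norm Δ).trans ?_) (by norm_num)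
      have h1 := hcmp p' hp'
      rw [hKjdef]
      exact h1
    have h₀ : |(fourierCoeff 𝒞a κ).re - (fourierCoeff 𝒞₁ κ).re| ≤
        2⁻¹ * (Kj j * T ^ 2) * (fourierCoeff 𝒞₀ κ).re := hΔle q (Or.inl rfl)
    have h₁ : |(fourierCoeff 𝒞a κ).re - (fourierCoeff 𝒞₁ κ).re| ≤
        2⁻¹ * (Kj j * T ^ 2) * (fourierCoeff 𝒞₁ κ).re := hΔle (q + y) (Or.inr (Or.inl rfl))
    have h₂ : |(fourierCoeff 𝒞a κ).re - (fourierCoeff 𝒞₁ κ).re| ≤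
        2⁻¹ * (Kj j * T ^ 2) * (fourierCoeff 𝒞₂ κ).re := hΔle (q + (2 : ℝ) • y) (Or.inr (Or.inr rfl))
    rw [hρκ]
    refine ⟨?_, h₁⟩
    calc |(fourierCoeff 𝒞a κ).re - (fourierCoeff 𝒞₁ κ).re|
        ≤ 2⁻¹ * (2⁻¹ * (Kj j * T ^ 2) * (fourierCoeff 𝒞₀ κ).re) +
            2⁻¹ * (2⁻¹ * (Kj j * T ^ 2) * (fourierCoeff 𝒞₂ κ).re) := by linarith
      _ = 2⁻¹ * (Kj j * T ^ 2) * (fourierCoeff 𝒞a κ).re := by rw [heA]; ring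
  have hcmpa : ∀ κ : Fin d → ZMod M,
      |(fourierCoeff 𝒞a κ).re - (fourierCoeff 𝒞₁ κ).re| ≤ ρm κ * (fourierCoeff 𝒞a κ).re := by
    intro κ
    by_cases hκ : κ = 0
    · rw [hκ, re_fourierCoeff_zero_of_sum_eq_zero h0a, re_fourierCoeff_zero_of_sum_eq_zero h0b,
        sub_self, abs_zero, mul_zero]
    · exact (hshell κ hκ).1
  have hcmpb : ∀ κ : Fin d → ZMod M,
      |(fourierCoeff 𝒞a κ).re - (fourierCoeff 𝒞₁ κ).re| ≤ ρm κ * (fourierCoeff 𝒞₁ κ).re := by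
    intro κ
    by_cases hκ : κ = 0
    · rw [hκ, re_fourierCoeff_zero_of_sum_eq_zero h0a, re_fourierCoeff_zero_of_sum_eq_zero h0b,
        sub_self, abs_zero, mul_zero]
    · exact (hshell κ hκ).2
  -- the Hilbert–Schmidt sum over shells
  have hρm_shell : ∀ κ : Fin d → ZMod M, κ ≠ 0 →
      ∃ j, InShell L j κ ∧ |ρm κ| ≤ E * (K2 / (L : ℝ) ^ ((k + 1 - j) * (ñ - n))) := by
    intro κ hκ
    refine ⟨Classical.choose (exists_inShell hL2 hκ), Classical.choose_spec (exists_inShell hL2 hκ), ?_⟩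
    set j := Classical.choose (exists_inShell hL2 hκ) with hjdef
    rw [abs_of_nonneg (hρm_nonneg κ)]
    have hρκ : ρm κ = 2⁻¹ * (Kj j * T ^ 2) := by simp only [hρmdef, dif_neg hκ, hjdef]
    rw [hρκ, hEdef, hKjdef]
    exact le_of_eq (by ring)
  have hsum := sum_sq_le_of_shellRatio (d := d) hL5 hM (k := k + 1) hd1 hgap (E := E) (K := K2) hρm0 hρm_shell
  set hS := Real.sqrt ((3 : ℝ) ^ (d + 1) * (L : ℝ) ^ ((N - (k + 1)) * d)) * (E * K2) with hhSdef
  have hhS0 : 0 ≤ hS := by positivity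
  have hsum' : ∑ κ, ρm κ ^ 2 ≤ hS ^ 2 := by
    rw [hhSdef, mul_pow, Real.sq_sqrt (by positivity)]
    calc ∑ κ, ρm κ ^ 2 ≤ (3 : ℝ) ^ (d + 1) * (E * K2) ^ 2 * (L : ℝ) ^ ((N - (k + 1)) * d) := hsum
      _ = (3 : ℝ) ^ (d + 1) * (L : ℝ) ^ ((N - (k + 1)) * d) * (E * K2) ^ 2 := by ring
  -- the dimension-free Lemma 8.4
  have hmain := tayNormLE_fluct_sub_fluct_of_sum_sq_pow_abkm hB hSa hSb hpq hSp hA𝒫p hea heb h0a h0b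
    hposa hpos₁ hρm_nonneg hcmpa hcmpb hhS0 hsum' hX hb hFd hFloc hF (pT := pT) (h := h) (A := A)
  convert hmain using 2

end Package

end Literature.MathematicalPhysics.StatisticalMechanics.GradientRG

end
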